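import Summits.ABC.IUTFork.LDHExplicitDeltaSplit
import Summits.ABC.IUTFork.LDHSlotResidue
import Literature.IUT.LogVolume.GenuineLogThetaSplitBadPrimes
import HarnessLib

/-!
# The fork at [IUTchIII] Corollary 3.12, L-DH level: the genuine `−|log(Θ)|` in the least-slot / bad-mass currency
# is TWO-SIDED — the split-bad-prime threshold is sharp up to the print-shaped constant

Record/proof-only file (D-0012) of the abc-iut cell (Cor. 3.12 crew, L-DH lane, seat abc-iut-c312-3; item
«XXVIIc-DH», sequel to `GenuineLogThetaSplitBadPrimes`). TAKES NO SIDE on [IUTchIII] Cor. 3.12. [IUTchIV] Thm. 1.10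
Step (v) (kurims p. 27–28: "`λ`" read at the chosen slot "`i†`", "after symmetrizing with respect to the choice of
`i† ∈ I`"); Dupuy–Hilado arXiv:2004.13228 §3.6, §4.7, §4.11–4.12; HOME/plan/c312/STEPV-IND1-NOTE.md (ruling R2).

Four landed kernel facts are composed. abc-iut-S8's LEAST-SLOT AGGREGATE `ndegLgpSlotMin(P_Θ; T) =
Σ_{p∈T}(1/ℓ⋇)Σ_jΣ_{v⃗}(min_k θ_j(v_k))·Π Pr` (`PilotSlotResidue`) brackets the genuine `−|log(Θ)|` of EVERY input `I`:
below by abc-iut-S8/c312-d1 (`LDHSlotResidue.neg_ndegLgp_add_slotResidue_le_negLogThetaNonarch`, every slot's bare region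
lies in the hull), above by abc-iut-c312-d1's Step (v) constant SPLIT by abc-iut-S8 (`LDHExplicitDeltaSplit`:
`explicitDelta = slotResidue + explicitDeltaRest`, with `hullEstimateOf_ofInput` and `ndegLgpOn = deĝ̲_lgp(P_Θ)`):

* **`negLogThetaNonarch_window`** — `−ndegLgpSlotMin ≤ negLogThetaNonarch I ≤ −ndegLgpSlotMin + explicitDeltaRest I`:
  with the full (Ind1), `−|log(Θ)|` IS minus the least-slot aggregate up to the PRINT-SHAPED constant
  `explicitDeltaRest` (different + tame terms, no `q`-dependence) — the symmetrised Step (v) bound is two-sided;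
* **`badMass_le_ndegLgpSlotMin`** — the least-slot aggregate in BAD-MASS currency: for any per-prime lower bound
  `μ_p ≤ P_q(v)·ln N(v)/n_v` on the bad places over `p`,
  `Σ_{p∈T(I)}(1/ℓ⋇)Σ_i (i+1)²·μ_p·β_p^{i+2} ≤ ndegLgpSlotMin(P_Θ; T(I))` (`β_p = Σ_{v|p, v∈𝕍^bad} Pr(v)`; only all-bad
  tuples carry a positive minimum; coordinate independence `Σ_e Π_k 1_S Pr = β^{i+2}`);
* **`badMass_szpiro_of_cor312Of`** — the NECESSARY condition: `Cor312Of I ⟹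
  Σ_{p∈T(I)}(1/ℓ⋇)Σ_i (i+1)²·μ_p·β_p^{i+2} − deĝ̲(P_q) ≤ explicitDeltaRest I + ((l+5)/4)·log π`.

READING (neutral): together with abc-iut-c312-3's SUFFICIENT condition `cor312Of_of_badMass_le`
(`(1/ℓ⋇)Σ_i (i+1)²·β_p^{i+1} ≤ 1` at every support prime ⇒ `Cor312Of I`) the bad-mass threshold is SHARP up to the
field constant: for a single bad place `v_p` over each bad prime (`μ_p = P_q(v_p)·ln N(v_p)/n_{v_p}`,
`μ_p·β_p = deĝ̲(P_q|_p)`) the necessary condition reads `Σ_p (c_p − 1)·deĝ̲(P_q|_p) ≤ explicitDeltaRest I + ((l+5)/4)·log π`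
with `c_p = (1/ℓ⋇)Σ_i (i+1)²·β_p^{i+1}` — vacuous exactly when every `c_p ≤ 1` (the TRUE regime), a Szpiro-type bound
on the `q`-depth as soon as some `c_p > 1` (the regime in which abc-iut-w5-d157's deep synthetic inputs make `Cor312Of`
FALSE; `β_p = 1` over `F_mod = ℚ`). So in the tree's sharp Dupuy–Hilado-level model the place combinatorics of
`(F₀, 𝕍^bad)` does not merely influence but DETERMINES, prime by prime, whether the typed inequality has
Diophantine content at all. [cite: Mochizuki2012, IUTchIV Thm. 1.10 Step (v) p. 27–28]
[cite: Mochizuki2012, IUTchIII Cor. 3.12 p. 173–174] [cite: DupuyHilado2025, §3.6, §4.7, §4.11, §4.12]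
[claim: Mochizuki2012, status: disputed] HONEST SCOPE: theorems about OUR typed objects ((Ind1) = all capsule-index
permutations); `Cor312Of` is a HYPOTHESIS in the necessary condition and asserted nowhere; no side taken.
PROOF-ONLY file: no definitions, no named `Prop` facts; typed ≠ proved.
-/

noncomputable section

namespace Summit.ABC.IUTFork

namespace DHData

open Literature.IUT.LogVolume NumberField IsDedekindDomain

variable {F₀ : Type} [Field F₀] [NumberField F₀] {K : Type} [Field K] [NumberField K] [Algebra F₀ K]
variable (I : ThetaVolumeInput F₀ K)

/-! ## The two-sided window in least-slot currency -/

/-- **Upper half**: `negLogThetaNonarch I ≤ −ndegLgpSlotMin(P_Θ; T(I)) + explicitDeltaRest I` (c312-d1's computable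
half with S8's split `explicitDelta = (ndegLgpOn − ndegLgpSlotMin) + explicitDeltaRest` and `ndegLgpOn = deĝ̲_lgp(P_Θ)`).
[cite: Mochizuki2012, IUTchIV Thm. 1.10 Step (v) p. 27–28] -/
theorem negLogThetaNonarch_le_neg_ndegLgpSlotMin_add_rest :
    I.negLogThetaNonarch ≤ -I.X.ndegLgpSlotMin I.supportPrimes + explicitDeltaRest I := by
  have h1 := hullEstimateOf_slotResidue_add_rest I
  have h2 : I.X.ndegLgpOn I.supportPrimes = LgpDivisor.ndegLgp I.X.thetaPilot := (ofInput I).ndegLgpOn_eq_ndegLgp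
  unfold ThetaVolumeInput.HullEstimateOf at h1
  rw [PilotData.slotResidue, h2] at h1
  linarith

/-- **The two-sided window**: `−ndegLgpSlotMin ≤ negLogThetaNonarch I ≤ −ndegLgpSlotMin + explicitDeltaRest I` — with the
full (Ind1) the genuine `−|log(Θ)|` is minus the least-slot aggregate up to the print-shaped (q-free) constant.
[cite: Mochizuki2012, IUTchIV Thm. 1.10 Step (v) p. 27–28] [cite: DupuyHilado2025, §4.7, §4.11, §4.12] -/
theorem negLogThetaNonarch_window :
    -I.X.ndegLgpSlotMin I.supportPrimes ≤ I.negLogThetaNonarch ∧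
      I.negLogThetaNonarch ≤ -I.X.ndegLgpSlotMin I.supportPrimes + explicitDeltaRest I := by
  refine ⟨?_, negLogThetaNonarch_le_neg_ndegLgpSlotMin_add_rest I⟩
  have h := neg_ndegLgp_add_slotResidue_le_negLogThetaNonarch I
  have h2 : I.X.ndegLgpOn I.supportPrimes = LgpDivisor.ndegLgp I.X.thetaPilot := (ofInput I).ndegLgpOn_eq_ndegLgp
  rw [PilotData.slotResidue, h2] at h
  linarith

/-! ## The least-slot aggregate in bad-mass currency -/

/-- The slot value `θ_j(v) = P_{Θ,j}(v)·ln N(v)/n_v` is nonnegative. [cite: DupuyHilado2025, §3.3] -/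
theorem thetaSlotValue_nonneg (i : Fin I.X.lstar) (v : HeightOneSpectrum (𝓞 F₀)) : 0 ≤ I.X.slotValue i v := by
  rw [PilotData.slotValue_eq_sq_mul]
  refine mul_nonneg (sq_nonneg _) (div_nonneg (mul_nonneg ?_ (logNorm_pos F₀ v).le) (Nat.cast_nonneg _))
  by_cases hv : v ∈ I.X.S
  · rw [I.X.qPilot_apply_of_mem hv]
    exact div_nonneg (by exact_mod_cast (I.X.ordq_pos hv).le) (by positivity)
  · rw [I.X.qPilot_apply_of_not_mem hv]

/-- **Bad mass under the least-slot aggregate**: for any per-prime lower bounds `μ_p ≤ P_q(v)·ln N(v)/n_v` on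
the bad places `v | p`, `Σ_{p∈T(I)}(1/ℓ⋇)Σ_i (i+1)²·μ_p·β_p^{i+2} ≤ ndegLgpSlotMin(P_Θ; T(I))`, `β_p` the bad mass
over `p` (at an all-bad tuple the minimum slot value is `≥ (i+1)²·μ_p`, elsewhere it is `≥ 0`; the all-bad tuples
have total weight `β_p^{i+2}` by coordinate independence). [cite: DupuyHilado2025, §3.6, §4.7]
[cite: Mochizuki2012, IUTchIV Thm. 1.10 Step (v) p. 27–28] -/
theorem badMass_le_ndegLgpSlotMin (μ : ℕ → ℝ)
    (hμ : ∀ (p : ℕ) (v : placesOver F₀ p), v.1 ∈ I.X.S →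
      μ p ≤ I.X.qPilot v.1 * logNorm F₀ v.1 / (localDegree F₀ v.1 : ℝ)) :
    ∑ p ∈ I.supportPrimes, (1 / (I.X.lstar : ℝ)) * ∑ i : Fin I.X.lstar, (((i : ℕ) + 1 : ℝ) ^ 2) * μ p *
        (∑ v : placesOver F₀ p, (I.X.S : Set (HeightOneSpectrum (𝓞 F₀))).indicator (weight F₀) v.1) ^
          ((i : ℕ) + 1 + 1) ≤
      I.X.ndegLgpSlotMin I.supportPrimes := by
  classical
  unfold PilotData.ndegLgpSlotMin
  refine Finset.sum_le_sum fun p _ => mul_le_mul_of_nonneg_left (Finset.sum_le_sum fun i _ => ?_) (by positivity)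
  -- at the degree `i`: expand `β^{i+2}` as a sum over tuples of the product of bad weights
  set badw : placesOver F₀ p → ℝ := fun v => (I.X.S : Set (HeightOneSpectrum (𝓞 F₀))).indicator (weight F₀) v.1
    with hbadw
  have hβ : (∑ v : placesOver F₀ p, badw v) ^ ((i : ℕ) + 1 + 1) =
      ∑ e : Fin ((i : ℕ) + 1 + 1) → placesOver F₀ p, ∏ k, badw (e k) := Fintype.sum_pow _ _
  rw [hβ, Finset.mul_sum]
  refine Finset.sum_le_sum fun e _ => ?_
  have hinf0 : 0 ≤ Finset.univ.inf' Finset.univ_nonempty (fun k => I.X.slotValue i (e k).1) :=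
    (Finset.le_inf'_iff _ _).mpr fun k _ => thetaSlotValue_nonneg I i (e k).1
  by_cases hall : ∀ k, (e k).1 ∈ I.X.S
  · -- all-bad tuple: the minimum slot value is `≥ (i+1)²·μ_p`, the bad weights are the weights
    have hprod : ∏ k, badw (e k) = ∏ k, weight F₀ (e k).1 :=
      Finset.prod_congr rfl fun k _ => by
        simp only [hbadw]
        exact Set.indicator_of_mem (Finset.mem_coe.mpr (hall k)) _
    have hmin : (((i : ℕ) + 1 : ℝ) ^ 2) * μ p ≤
        Finset.univ.inf' Finset.univ_nonempty (fun k => I.X.slotValue i (e k).1) := by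
      refine (Finset.le_inf'_iff _ _).mpr fun k _ => ?_
      rw [PilotData.slotValue_eq_sq_mul]
      exact mul_le_mul_of_nonneg_left (hμ p (e k) (hall k)) (sq_nonneg _)
    rw [hprod]
    exact mul_le_mul_of_nonneg_right hmin (PilotData.prod_weight_nonneg e)
  · -- a good slot: the bad-weight product vanishes
    obtain ⟨a, ha⟩ := not_forall.mp hall
    have hprod : ∏ k, badw (e k) = 0 :=
      Finset.prod_eq_zero (Finset.mem_univ a) (by
        simp only [hbadw]
        exact Set.indicator_of_notMem (fun h => ha (Finset.mem_coe.mp h)) _)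
    rw [hprod, mul_zero]
    exact mul_nonneg hinf0 (PilotData.prod_weight_nonneg e)

/-- **Upper bound on the genuine `−|log(Θ)|` in bad-mass currency**:
`negLogThetaNonarch I ≤ −Σ_{p∈T(I)}(1/ℓ⋇)Σ_i (i+1)²·μ_p·β_p^{i+2} + explicitDeltaRest I`.
[cite: Mochizuki2012, IUTchIV Thm. 1.10 Step (v) p. 27–28] [cite: DupuyHilado2025, §3.6, §4.7, §4.12] -/
theorem negLogThetaNonarch_le_badMass (μ : ℕ → ℝ)
    (hμ : ∀ (p : ℕ) (v : placesOver F₀ p), v.1 ∈ I.X.S →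
      μ p ≤ I.X.qPilot v.1 * logNorm F₀ v.1 / (localDegree F₀ v.1 : ℝ)) :
    I.negLogThetaNonarch ≤
      -(∑ p ∈ I.supportPrimes, (1 / (I.X.lstar : ℝ)) * ∑ i : Fin I.X.lstar, (((i : ℕ) + 1 : ℝ) ^ 2) * μ p *
        (∑ v : placesOver F₀ p, (I.X.S : Set (HeightOneSpectrum (𝓞 F₀))).indicator (weight F₀) v.1) ^
          ((i : ℕ) + 1 + 1)) + explicitDeltaRest I := by
  have h1 := negLogThetaNonarch_le_neg_ndegLgpSlotMin_add_rest I
  have h2 := badMass_le_ndegLgpSlotMin I μ hμ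
  linarith

/-- **The NECESSARY condition in bad-mass currency**: if [IUTchIII] Cor. 3.12 holds for the genuine input `I`
(`Cor312Of I`, a HYPOTHESIS), then `Σ_{p∈T(I)}(1/ℓ⋇)Σ_i (i+1)²·μ_p·β_p^{i+2} − deĝ̲(P_q) ≤ explicitDeltaRest I + ((l+5)/4)·log π`
for any admissible `μ`. With one bad place `v_p` per bad prime and `μ_p = P_q(v_p)·ln N(v_p)/n_{v_p}` this is
`Σ_p (c_p − 1)·deĝ̲(P_q|_p) ≤ explicitDeltaRest I + ((l+5)/4)·log π`, `c_p = (1/ℓ⋇)Σ_i (i+1)²·β_p^{i+1}` — vacuous iff every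
`c_p ≤ 1` (where `cor312Of_of_badMass_le` PROVES `Cor312Of`), a Szpiro-type depth bound otherwise. Nothing asserted
about any input; no side taken. [claim: Mochizuki2012, status: disputed] [cite: Mochizuki2012, IUTchIII Cor. 3.12 p. 173–174]
[cite: Mochizuki2012, IUTchIV Thm. 1.10 Step (v)–(viii) p. 27–30] -/
theorem badMass_szpiro_of_cor312Of (h312 : I.Cor312Of) (μ : ℕ → ℝ)
    (hμ : ∀ (p : ℕ) (v : placesOver F₀ p), v.1 ∈ I.X.S →
      μ p ≤ I.X.qPilot v.1 * logNorm F₀ v.1 / (localDegree F₀ v.1 : ℝ)) :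
    (∑ p ∈ I.supportPrimes, (1 / (I.X.lstar : ℝ)) * ∑ i : Fin I.X.lstar, (((i : ℕ) + 1 : ℝ) ^ 2) * μ p *
        (∑ v : placesOver F₀ p, (I.X.S : Set (HeightOneSpectrum (𝓞 F₀))).indicator (weight F₀) v.1) ^
          ((i : ℕ) + 1 + 1)) - FinDivisor.ndeg F₀ I.X.qPilot ≤
      explicitDeltaRest I + ThetaVolumeInput.archLogTheta I.l := by
  have h1 := negLogThetaNonarch_le_badMass I μ hμ
  unfold ThetaVolumeInput.Cor312Of ThetaVolumeInput.negLogTheta ThetaVolumeInput.negAbsLogQ at h312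
  linarith

/-! ## One bad place per bad prime: the threshold `c_p = 1` in closed form -/

/-- At a prime over which `v₀` is the ONLY bad place, the bad mass is `Pr(v₀)`. [cite: DupuyHilado2025, §3.6] -/
theorem badMass_eq_weight_of_lone {p : ℕ} (v₀ : placesOver F₀ p) (hv₀ : v₀.1 ∈ I.X.S)
    (hlone : ∀ v : placesOver F₀ p, v.1 ∈ I.X.S → v = v₀) :
    ∑ v : placesOver F₀ p, (I.X.S : Set (HeightOneSpectrum (𝓞 F₀))).indicator (weight F₀) v.1 =
      weight F₀ v₀.1 := by
  classical
  rw [Finset.sum_eq_single v₀]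
  · exact Set.indicator_of_mem (Finset.mem_coe.mpr hv₀) _
  · intro v _ hv
    exact Set.indicator_of_notMem (fun h => hv (hlone v (Finset.mem_coe.mp h))) _
  · intro h; exact absurd (Finset.mem_univ v₀) h

/-- At a prime over which `v₀` is the ONLY bad place, `deĝ̲(P_q|_p) = (P_q(v₀)·ln N(v₀)/n_{v₀})·Pr(v₀)`.
[cite: DupuyHilado2025, §3.3, §3.6] -/
theorem ndeg_qPilot_at_eq_of_lone {p : ℕ} (v₀ : placesOver F₀ p) (hlone : ∀ v : placesOver F₀ p, v.1 ∈ I.X.S → v = v₀) :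
    FinDivisor.ndeg F₀ (∑ v : placesOver F₀ p, FinDivisor.of v.1 (I.X.qPilot v.1)) =
      I.X.qPilot v₀.1 * logNorm F₀ v₀.1 / (localDegree F₀ v₀.1 : ℝ) * weight F₀ v₀.1 := by
  classical
  rw [map_sum, Finset.sum_eq_single v₀]
  · rw [FinDivisor.ndeg_of, weight]
    have hn : (localDegree F₀ v₀.1 : ℝ) ≠ 0 := by exact_mod_cast (localDegree_pos F₀ v₀.1).ne'
    field_simp
  · intro v _ hv
    have hS : v.1 ∉ I.X.S := fun h => hv (hlone v h)
    rw [I.X.qPilot_apply_of_not_mem hS, FinDivisor.ndeg_of, zero_mul, zero_div]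
  · intro h; exact absurd (Finset.mem_univ v₀) h

/-- At a prime with NO bad place over it, the bad mass vanishes. [cite: DupuyHilado2025, §3.6] -/
theorem badMass_eq_zero_of_none {p : ℕ} (hnone : ∀ v : placesOver F₀ p, v.1 ∉ I.X.S) :
    ∑ v : placesOver F₀ p, (I.X.S : Set (HeightOneSpectrum (𝓞 F₀))).indicator (weight F₀) v.1 = 0 :=
  Finset.sum_eq_zero fun v _ => Set.indicator_of_notMem (fun h => hnone v (Finset.mem_coe.mp h)) _

/-- At a prime with NO bad place over it, `deĝ̲(P_q|_p) = 0`. [cite: DupuyHilado2025, §3.3] -/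
theorem ndeg_qPilot_at_eq_zero_of_none {p : ℕ} (hnone : ∀ v : placesOver F₀ p, v.1 ∉ I.X.S) :
    FinDivisor.ndeg F₀ (∑ v : placesOver F₀ p, FinDivisor.of v.1 (I.X.qPilot v.1)) = 0 := by
  rw [map_sum]
  exact Finset.sum_eq_zero fun v _ => by rw [I.X.qPilot_apply_of_not_mem (hnone v), FinDivisor.ndeg_of, zero_mul, zero_div]

/-- **THE THRESHOLD IN CLOSED FORM (at most one bad place over each prime).** If [IUTchIII] Cor. 3.12 holds for the
genuine input `I` (`Cor312Of I`, a HYPOTHESIS) and every rational prime carries at most one place of `𝕍^bad`, then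
`Σ_{p∈T(I)} (c_p − 1)·deĝ̲(P_q|_p) ≤ explicitDeltaRest I + ((l+5)/4)·log π`, `c_p = (1/ℓ⋇)Σ_{i<ℓ⋇} (i+1)²·β_p^{i+1}`,
`β_p = Pr(v_p)` the relative local degree of the bad place over `p` (`0` if none) — the SAME `c_p` whose bound `c_p ≤ 1`
PROVES `Cor312Of I` (`ThetaVolumeInput.cor312Of_of_badMass_le`): below the threshold the typed inequality holds
outright, above it it is a Szpiro-type bound on the `q`-depths `deĝ̲(P_q|_p)` by the print-shaped constant. Nothing
asserted about any input; no side taken. [claim: Mochizuki2012, status: disputed]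
[cite: Mochizuki2012, IUTchIII Cor. 3.12 p. 173–174] [cite: Mochizuki2012, IUTchIV Thm. 1.10 Step (v)–(viii) p. 27–30] -/
theorem badMass_threshold_of_cor312Of_of_lone (h312 : I.Cor312Of)
    (hlone : ∀ (p : ℕ) (v w : placesOver F₀ p), v.1 ∈ I.X.S → w.1 ∈ I.X.S → v = w) :
    ∑ p ∈ I.supportPrimes, ((1 / (I.X.lstar : ℝ)) * ∑ i : Fin I.X.lstar, (((i : ℕ) + 1 : ℝ) ^ 2) *
        (∑ v : placesOver F₀ p, (I.X.S : Set (HeightOneSpectrum (𝓞 F₀))).indicator (weight F₀) v.1) ^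
          ((i : ℕ) + 1) - 1) *
        FinDivisor.ndeg F₀ (∑ v : placesOver F₀ p, FinDivisor.of v.1 (I.X.qPilot v.1)) ≤
      explicitDeltaRest I + ThetaVolumeInput.archLogTheta I.l := by
  classical
  -- the lower bound `μ_p`: the `q`-slot value of the (unique) bad place over `p`, if any
  let μ : ℕ → ℝ := fun p =>
    if h : ∃ v : placesOver F₀ p, v.1 ∈ I.X.S then
      I.X.qPilot h.choose.1 * logNorm F₀ h.choose.1 / (localDegree F₀ h.choose.1 : ℝ) else 0
  have hμ : ∀ (p : ℕ) (v : placesOver F₀ p), v.1 ∈ I.X.S →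
      μ p ≤ I.X.qPilot v.1 * logNorm F₀ v.1 / (localDegree F₀ v.1 : ℝ) := by
    intro p v hv
    have h : ∃ v : placesOver F₀ p, v.1 ∈ I.X.S := ⟨v, hv⟩
    have hμp : μ p = I.X.qPilot h.choose.1 * logNorm F₀ h.choose.1 / (localDegree F₀ h.choose.1 : ℝ) := dif_pos h
    rw [hμp, hlone p h.choose v h.choose_spec hv]
  have hmain := badMass_szpiro_of_cor312Of I h312 μ hμ
  rw [I.ndeg_qPilot_eq_sum_primes] at hmain
  -- per prime: `(1/ℓ⋇)Σ_i (i+1)²·μ_p·β_p^{i+2} = c_p·deĝ̲(P_q|_p)`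
  have hp : ∀ p ∈ I.supportPrimes,
      (1 / (I.X.lstar : ℝ)) * ∑ i : Fin I.X.lstar, (((i : ℕ) + 1 : ℝ) ^ 2) * μ p *
          (∑ v : placesOver F₀ p, (I.X.S : Set (HeightOneSpectrum (𝓞 F₀))).indicator (weight F₀) v.1) ^
            ((i : ℕ) + 1 + 1) =
        ((1 / (I.X.lstar : ℝ)) * ∑ i : Fin I.X.lstar, (((i : ℕ) + 1 : ℝ) ^ 2) *
          (∑ v : placesOver F₀ p, (I.X.S : Set (HeightOneSpectrum (𝓞 F₀))).indicator (weight F₀) v.1) ^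
            ((i : ℕ) + 1)) *
          FinDivisor.ndeg F₀ (∑ v : placesOver F₀ p, FinDivisor.of v.1 (I.X.qPilot v.1)) := by
    intro p _
    rw [Finset.mul_sum, Finset.mul_sum, Finset.sum_mul]
    refine Finset.sum_congr rfl fun i _ => ?_
    by_cases h : ∃ v : placesOver F₀ p, v.1 ∈ I.X.S
    · have hμp : μ p = I.X.qPilot h.choose.1 * logNorm F₀ h.choose.1 / (localDegree F₀ h.choose.1 : ℝ) :=
        dif_pos h
      have hl : ∀ v : placesOver F₀ p, v.1 ∈ I.X.S → v = h.choose := fun v hv => hlone p v h.choose hv h.choose_spec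
      rw [hμp, badMass_eq_weight_of_lone I h.choose h.choose_spec hl, ndeg_qPilot_at_eq_of_lone I h.choose hl]
      ring
    · have hnone : ∀ v : placesOver F₀ p, v.1 ∉ I.X.S := fun v hv => h ⟨v, hv⟩
      rw [badMass_eq_zero_of_none I hnone, ndeg_qPilot_at_eq_zero_of_none I hnone]
      simp
  have hsum : ∑ p ∈ I.supportPrimes, (1 / (I.X.lstar : ℝ)) * ∑ i : Fin I.X.lstar, (((i : ℕ) + 1 : ℝ) ^ 2) * μ p *
        (∑ v : placesOver F₀ p, (I.X.S : Set (HeightOneSpectrum (𝓞 F₀))).indicator (weight F₀) v.1) ^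
          ((i : ℕ) + 1 + 1) =
      ∑ p ∈ I.supportPrimes, ((1 / (I.X.lstar : ℝ)) * ∑ i : Fin I.X.lstar, (((i : ℕ) + 1 : ℝ) ^ 2) *
        (∑ v : placesOver F₀ p, (I.X.S : Set (HeightOneSpectrum (𝓞 F₀))).indicator (weight F₀) v.1) ^
          ((i : ℕ) + 1)) *
        FinDivisor.ndeg F₀ (∑ v : placesOver F₀ p, FinDivisor.of v.1 (I.X.qPilot v.1)) :=
    Finset.sum_congr rfl hp
  rw [hsum, ← Finset.sum_sub_distrib] at hmain
  calc _ = ∑ p ∈ I.supportPrimes, (((1 / (I.X.lstar : ℝ)) * ∑ i : Fin I.X.lstar, (((i : ℕ) + 1 : ℝ) ^ 2) *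
          (∑ v : placesOver F₀ p, (I.X.S : Set (HeightOneSpectrum (𝓞 F₀))).indicator (weight F₀) v.1) ^
            ((i : ℕ) + 1)) *
          FinDivisor.ndeg F₀ (∑ v : placesOver F₀ p, FinDivisor.of v.1 (I.X.qPilot v.1)) -
          FinDivisor.ndeg F₀ (∑ v : placesOver F₀ p, FinDivisor.of v.1 (I.X.qPilot v.1))) :=
        Finset.sum_congr rfl fun p _ => by ring
    _ ≤ _ := hmain

end DHData

end Summit.ABC.IUTFork

end
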